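import Literature.Geometry.Riemannian.SpherePresentation
import Literature.Geometry.Riemannian.MetricComponentsInverse
import Literature.Geometry.Riemannian.OpensTangentLift
import Mathlib.Analysis.SpecialFunctions.Sqrt
import HarnessLib

/-!
# The unit normal field of the round sphere for a chart metric, as data for the cone map

Topic `Geometry/Riemannian`. In the round picture of the interior surgery of Weinstein's disk
(Weinstein 1968, proof of the main theorem, step (3)) the boundary of the disk is the unit sphere
`S = {‖v‖ = 1}` of the model open set `U : Opens V`, carrying a Riemannian chart metric `g_U`
with components `G_U`. Its outward `g_U`-unit normal at `p ∈ S` is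
`ν(p) = N(p)/|N(p)|_{g_U}` with the raw normal `N(p) = ♯⟪p, ·⟫ = (G_U p)⁻¹ ⟪p, ·⟫`
(`MetricComponentsInverse.lean`; Lee 2018, (8.9)/Example 8.25: `N = grad F/|grad F|` for the
defining function `F = ‖x‖²`). Together with the presentation `ι(v) = φ⁻¹(v/‖v‖)`
(`SpherePresentation.lean`) this file delivers exactly the hypotheses of the cone-map layer
(`ConeRadialIsometry.lean`, `ConeRadialIsometryInjective.lean`, `ConeExitDerivative.lean`) for
`M := U`:

* `val_rawNormal`, `rawNormal_ne_zero`, `val_rawNormal_self_pos` — `g_U(N p, w) = ⟪p, w⟫`,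
  `N p ≠ 0`, `g_U(N, N) > 0`;
* `val_sphereNormal_self` (**hunit**), `val_sphereNormal` — `g_U(ν, ν) = 1`, `g_U(ν, w) = c ⟪p, w⟫`;
* `contDiffAt_sphereNormal`, `contMDiffOn_spherePresentation_normal` (**hs**) — smoothness;
* `val_mfderiv_spherePresentation_normal` (**hperp**), `spherePresentation_normal_smul`
  (**hhom**), `mfderiv_spherePresentation_eq_zero` (**himm**).

## References

* J. M. Lee, *Introduction to Riemannian Manifolds*, 2nd ed. (2018), Prop. 8.? / Example 8.25
  and p. 251 (`N = grad F/|grad F|` for a local defining function).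
  [cite: LeeRiemannianManifolds2018, Example 8.25]
* A. Weinstein, Ann. of Math. (2) 87 (1968), 29–41, proof of the main theorem, step (3).
  [cite: Weinstein1968]

Tags: [Sphere] [UnitNormal] [Weinstein1968]
-/

noncomputable section

open Bundle Set Function Filter TopologicalSpace
open scoped Manifold ContDiff Topology RealInnerProductSpace

namespace Literature.Geometry.Riemannian

open Literature.Geometry.Lorentzian
open Literature.Geometry.Lorentzian.OpensChart

variable {V : Type*} [NormedAddCommGroup V] [InnerProductSpace ℝ V] [FiniteDimensional ℝ V]
  {U : Opens V}
  (gU : PseudoRiemannianMetric 𝓘(ℝ, V) ∞ V (TangentSpace 𝓘(ℝ, V) : U → Type _))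
  (GU : V → V →L[ℝ] V →L[ℝ] ℝ)

/-! ### The raw normal `N p = (G_U p)⁻¹ ⟪p, ·⟫` -/

/-- **`g_U(N p, w) = ⟪p, w⟫`.** [cite: LeeRiemannianManifolds2018, Example 8.25] -/
theorem val_rawNormal (hG : ∀ y : U, gU.val y = GU y) (p : U) (w : V) :
    gU.val p ((GU p).inverse (innerSL ℝ (p : V))) w = ⟪(p : V), w⟫ := by
  rw [val_inverse_metricComponents_apply gU GU hG p]
  rfl

/-- **`N p ≠ 0`** for `p ≠ 0`. [folklore] -/
theorem rawNormal_ne_zero (hG : ∀ y : U, gU.val y = GU y) (p : U) (hp : (p : V) ≠ 0) :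
    (GU p).inverse (innerSL ℝ (p : V)) ≠ 0 := by
  intro h0
  have h1 := DFunLike.congr_fun (apply_inverse_metricComponents gU GU hG p (innerSL ℝ (p : V)))
    (p : V)
  rw [h0, map_zero, innerSL_apply_apply] at h1
  have h2 : ⟪(p : V), (p : V)⟫ = 0 := by rw [← h1]; rfl
  exact hp (inner_self_eq_zero.1 h2)

/-- **`g_U(N p, N p) > 0`** for `p ≠ 0` and `g_U` Riemannian. [folklore] -/
theorem val_rawNormal_self_pos (hG : ∀ y : U, gU.val y = GU y) (hgU : gU.IsRiemannian) (p : U)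
    (hp : (p : V) ≠ 0) :
    0 < GU p ((GU p).inverse (innerSL ℝ (p : V))) ((GU p).inverse (innerSL ℝ (p : V))) := by
  have h := hgU p _ (rawNormal_ne_zero gU GU hG p hp)
  rw [hG p] at h
  exact h

/-! ### The unit normal `ν p = (√ g_U(N, N))⁻¹ N` -/

/-- **hunit: `g_U(ν p, ν p) = 1`.** [cite: LeeRiemannianManifolds2018, Example 8.25] -/
theorem val_sphereNormal_self (hG : ∀ y : U, gU.val y = GU y) (hgU : gU.IsRiemannian) (p : U)
    (hp : (p : V) ≠ 0) :
    gU.val p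
      ((Real.sqrt (GU p ((GU p).inverse (innerSL ℝ (p : V))) ((GU p).inverse (innerSL ℝ (p : V)))))⁻¹ •
        (GU p).inverse (innerSL ℝ (p : V)))
      ((Real.sqrt (GU p ((GU p).inverse (innerSL ℝ (p : V))) ((GU p).inverse (innerSL ℝ (p : V)))))⁻¹ •
        (GU p).inverse (innerSL ℝ (p : V))) = 1 := by
  set N : V := (GU p).inverse (innerSL ℝ (p : V)) with hN
  set q : ℝ := GU p N N with hq
  have hqpos : 0 < q := val_rawNormal_self_pos gU GU hG hgU p hp
  have key : GU (p : V) ((Real.sqrt q)⁻¹ • N) ((Real.sqrt q)⁻¹ • N) = 1 := by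
    rw [ContinuousLinearMap.map_smul₂, map_smul, smul_eq_mul, smul_eq_mul]
    show (Real.sqrt q)⁻¹ * ((Real.sqrt q)⁻¹ * q) = 1
    rw [← mul_assoc, ← mul_inv, Real.mul_self_sqrt hqpos.le, inv_mul_cancel₀ hqpos.ne']
  exact (DFunLike.congr_fun (DFunLike.congr_fun (hG p) _) _).trans key

/-- **`g_U(ν p, w) = (√ g_U(N,N))⁻¹ ⟪p, w⟫`.** [folklore] -/
theorem val_sphereNormal (hG : ∀ y : U, gU.val y = GU y) (p : U) (w : V) :
    gU.val p
      ((Real.sqrt (GU p ((GU p).inverse (innerSL ℝ (p : V))) ((GU p).inverse (innerSL ℝ (p : V)))))⁻¹ •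
        (GU p).inverse (innerSL ℝ (p : V))) w =
      (Real.sqrt (GU p ((GU p).inverse (innerSL ℝ (p : V))) ((GU p).inverse (innerSL ℝ (p : V)))))⁻¹ *
        ⟪(p : V), w⟫ := by
  set N : V := (GU p).inverse (innerSL ℝ (p : V)) with hN
  have h := val_rawNormal gU GU hG p w
  have h' : GU (p : V) N w = ⟪(p : V), w⟫ :=
    (DFunLike.congr_fun (DFunLike.congr_fun (hG p) N) w).symm.trans h
  have key : GU (p : V) ((Real.sqrt (GU p N N))⁻¹ • N) w = (Real.sqrt (GU p N N))⁻¹ * ⟪(p : V), w⟫ := by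
    rw [ContinuousLinearMap.map_smul₂, smul_eq_mul, h']
  exact (DFunLike.congr_fun (DFunLike.congr_fun (hG p) _) _).trans key

/-- **The unit normal is `C^∞`** as a function of the point, at every `p ∈ U` with `p ≠ 0` (for a
Riemannian `g_U`): `p ↦ (G_U p)⁻¹` is smooth (`contDiffAt_inverse_metricComponents`), `innerSL`
is linear, `q ↦ (√q)⁻¹` is smooth on `q > 0`. [folklore] -/
theorem contDiffAt_sphereNormal (hG : ∀ y : U, gU.val y = GU y) (hgU : gU.IsRiemannian) (p : U)
    (hp : (p : V) ≠ 0) :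
    ContDiffAt ℝ ∞ (fun v : V ↦
      (Real.sqrt (GU v ((GU v).inverse (innerSL ℝ v)) ((GU v).inverse (innerSL ℝ v))))⁻¹ •
        (GU v).inverse (innerSL ℝ v)) p := by
  have hinv := contDiffAt_inverse_metricComponents gU GU hG p
  have hlin : ContDiffAt ℝ ∞ (fun v : V ↦ (innerSL ℝ v : V →L[ℝ] ℝ)) p :=
    (innerSL ℝ : V →L[ℝ] V →L[ℝ] ℝ).contDiff.contDiffAt
  have hN : ContDiffAt ℝ ∞ (fun v : V ↦ (GU v).inverse (innerSL ℝ v)) p := hinv.clm_apply hlin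
  have hq : ContDiffAt ℝ ∞ (fun v : V ↦ GU v ((GU v).inverse (innerSL ℝ v))
      ((GU v).inverse (innerSL ℝ v))) p :=
    ((contDiffAt_metricComponents gU GU hG p).clm_apply hN).clm_apply hN
  have hqpos := val_rawNormal_self_pos gU GU hG hgU p hp
  have hsqrt : ContDiffAt ℝ ∞ (fun v : V ↦
      (Real.sqrt (GU v ((GU v).inverse (innerSL ℝ v)) ((GU v).inverse (innerSL ℝ v))))⁻¹) p :=
    (hq.sqrt hqpos.ne').inv (Real.sqrt_pos.2 hqpos).ne'
  exact hsqrt.smul hN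

/-! ### With the presentation `ι v = φ⁻¹(v/‖v‖)`: the data of the cone map -/

/-- **hs: `v ↦ (ι v, ν(ι v)) ∈ TU` is `C^∞` on `V ∖ {0}`** when the unit sphere lies in `U`.
[cite: Weinstein1968, proof of the main theorem, step (3)] -/
theorem contMDiffOn_spherePresentation_normal (hG : ∀ y : U, gU.val y = GU y)
    (hgU : gU.IsRiemannian) (u₀ : U) (hSU : ∀ w : V, ‖w‖ = 1 → w ∈ U) :
    ContMDiffOn 𝓘(ℝ, V) 𝓘(ℝ, V).tangent ∞
      (fun v : V ↦ (TotalSpace.mk' V ((extChartAt 𝓘(ℝ, V) u₀).symm (‖v‖⁻¹ • v))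
        ((Real.sqrt (GU (((extChartAt 𝓘(ℝ, V) u₀).symm (‖v‖⁻¹ • v) : U) : V)
          ((GU (((extChartAt 𝓘(ℝ, V) u₀).symm (‖v‖⁻¹ • v) : U) : V)).inverse
            (innerSL ℝ (((extChartAt 𝓘(ℝ, V) u₀).symm (‖v‖⁻¹ • v) : U) : V)))
          ((GU (((extChartAt 𝓘(ℝ, V) u₀).symm (‖v‖⁻¹ • v) : U) : V)).inverse
            (innerSL ℝ (((extChartAt 𝓘(ℝ, V) u₀).symm (‖v‖⁻¹ • v) : U) : V)))))⁻¹ •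
          (GU (((extChartAt 𝓘(ℝ, V) u₀).symm (‖v‖⁻¹ • v) : U) : V)).inverse
            (innerSL ℝ (((extChartAt 𝓘(ℝ, V) u₀).symm (‖v‖⁻¹ • v) : U) : V)) :
          TangentSpace 𝓘(ℝ, V) ((extChartAt 𝓘(ℝ, V) u₀).symm (‖v‖⁻¹ • v))) :
        TangentBundle 𝓘(ℝ, V) U)) {v : V | v ≠ 0} := by
  -- the normal as a smooth section near the sphere, and the presentation
  set νf : V → V := fun w : V ↦
    (Real.sqrt (GU w ((GU w).inverse (innerSL ℝ w)) ((GU w).inverse (innerSL ℝ w))))⁻¹ •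
      (GU w).inverse (innerSL ℝ w) with hνf
  set ι : V → U := fun v : V ↦ (extChartAt 𝓘(ℝ, V) u₀).symm (‖v‖⁻¹ • v) with hι
  intro v hv
  have hv' : v ≠ 0 := hv
  have hιv : ((ι v : U) : V) = ‖v‖⁻¹ • v := coe_spherePresentation u₀ hSU hv'
  have hιv0 : ((ι v : U) : V) ≠ 0 := by
    rw [hιv]
    exact smul_ne_zero (inv_ne_zero (norm_ne_zero_iff.2 hv')) hv'
  -- the section `p ↦ (p, νf p)` is smooth at `ι v`
  have hsec : ContMDiffAt 𝓘(ℝ, V) 𝓘(ℝ, V).tangent ∞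
      (fun p : U ↦ (TotalSpace.mk' V p (νf (p : V) : TangentSpace 𝓘(ℝ, V) p) :
        TangentBundle 𝓘(ℝ, V) U)) (ι v) := by
    refine contMDiffAt_opensLift_iff.2 ⟨contMDiffAt_id, ?_⟩
    exact (OpensChart.contMDiffAt_iff (ι v) (fun p : U ↦ νf (p : V)) νf (fun _ ↦ rfl)).2
      (contDiffAt_sphereNormal gU GU hG hgU (ι v) hιv0)
  have hιs : ContMDiffAt 𝓘(ℝ, V) 𝓘(ℝ, V) ∞ ι v :=
    (contMDiffOn_spherePresentation u₀ hSU v hv).contMDiffAt (isOpen_ne.mem_nhds hv')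
  exact (hsec.comp v hιs).contMDiffWithinAt

/-- **hperp: `g_U(dι_v z, ν(ι v)) = 0`** — `dι_v z = dN_v z ⊥ v` in `V` and `g_U(ν, w) = c⟪ι v, w⟫`,
`ι v = v/‖v‖`. [cite: LeeRiemannianManifolds2018, Example 8.25] -/
theorem val_mfderiv_spherePresentation_normal (hG : ∀ y : U, gU.val y = GU y) (u₀ : U)
    (hSU : ∀ w : V, ‖w‖ = 1 → w ∈ U) {v : V} (hv : v ≠ 0) (z : V) :
    gU.val ((extChartAt 𝓘(ℝ, V) u₀).symm (‖v‖⁻¹ • v))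
      (mfderiv 𝓘(ℝ, V) 𝓘(ℝ, V) (fun v : V ↦ (extChartAt 𝓘(ℝ, V) u₀).symm (‖v‖⁻¹ • v)) v z)
      ((Real.sqrt (GU (((extChartAt 𝓘(ℝ, V) u₀).symm (‖v‖⁻¹ • v) : U) : V)
          ((GU (((extChartAt 𝓘(ℝ, V) u₀).symm (‖v‖⁻¹ • v) : U) : V)).inverse
            (innerSL ℝ (((extChartAt 𝓘(ℝ, V) u₀).symm (‖v‖⁻¹ • v) : U) : V)))
          ((GU (((extChartAt 𝓘(ℝ, V) u₀).symm (‖v‖⁻¹ • v) : U) : V)).inverse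
            (innerSL ℝ (((extChartAt 𝓘(ℝ, V) u₀).symm (‖v‖⁻¹ • v) : U) : V)))))⁻¹ •
          (GU (((extChartAt 𝓘(ℝ, V) u₀).symm (‖v‖⁻¹ • v) : U) : V)).inverse
            (innerSL ℝ (((extChartAt 𝓘(ℝ, V) u₀).symm (‖v‖⁻¹ • v) : U) : V))) = 0 := by
  set p : U := (extChartAt 𝓘(ℝ, V) u₀).symm (‖v‖⁻¹ • v) with hp
  have hpv : (p : V) = ‖v‖⁻¹ • v := coe_spherePresentation u₀ hSU hv
  rw [gU.symm p, val_sphereNormal gU GU hG p, mfderiv_spherePresentation_apply u₀ hSU hv z, hpv,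
    inner_smul_left, inner_fderiv_normalize hv z]
  simp

omit [FiniteDimensional ℝ V] in
/-- **hhom: positive `0`-homogeneity of `v ↦ (ι v, ν(ι v)) ∈ TU`.** [folklore] -/
theorem spherePresentation_normal_smul (u₀ : U) {t : ℝ} (ht : 0 < t) (v : V) :
    (TotalSpace.mk' V ((extChartAt 𝓘(ℝ, V) u₀).symm (‖t • v‖⁻¹ • (t • v)))
        ((Real.sqrt (GU (((extChartAt 𝓘(ℝ, V) u₀).symm (‖t • v‖⁻¹ • (t • v)) : U) : V)
          ((GU (((extChartAt 𝓘(ℝ, V) u₀).symm (‖t • v‖⁻¹ • (t • v)) : U) : V)).inverse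
            (innerSL ℝ (((extChartAt 𝓘(ℝ, V) u₀).symm (‖t • v‖⁻¹ • (t • v)) : U) : V)))
          ((GU (((extChartAt 𝓘(ℝ, V) u₀).symm (‖t • v‖⁻¹ • (t • v)) : U) : V)).inverse
            (innerSL ℝ (((extChartAt 𝓘(ℝ, V) u₀).symm (‖t • v‖⁻¹ • (t • v)) : U) : V)))))⁻¹ •
          (GU (((extChartAt 𝓘(ℝ, V) u₀).symm (‖t • v‖⁻¹ • (t • v)) : U) : V)).inverse
            (innerSL ℝ (((extChartAt 𝓘(ℝ, V) u₀).symm (‖t • v‖⁻¹ • (t • v)) : U) : V)) :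
          TangentSpace 𝓘(ℝ, V) ((extChartAt 𝓘(ℝ, V) u₀).symm (‖t • v‖⁻¹ • (t • v)))) :
        TangentBundle 𝓘(ℝ, V) U) =
      TotalSpace.mk' V ((extChartAt 𝓘(ℝ, V) u₀).symm (‖v‖⁻¹ • v))
        ((Real.sqrt (GU (((extChartAt 𝓘(ℝ, V) u₀).symm (‖v‖⁻¹ • v) : U) : V)
          ((GU (((extChartAt 𝓘(ℝ, V) u₀).symm (‖v‖⁻¹ • v) : U) : V)).inverse
            (innerSL ℝ (((extChartAt 𝓘(ℝ, V) u₀).symm (‖v‖⁻¹ • v) : U) : V)))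
          ((GU (((extChartAt 𝓘(ℝ, V) u₀).symm (‖v‖⁻¹ • v) : U) : V)).inverse
            (innerSL ℝ (((extChartAt 𝓘(ℝ, V) u₀).symm (‖v‖⁻¹ • v) : U) : V)))))⁻¹ •
          (GU (((extChartAt 𝓘(ℝ, V) u₀).symm (‖v‖⁻¹ • v) : U) : V)).inverse
            (innerSL ℝ (((extChartAt 𝓘(ℝ, V) u₀).symm (‖v‖⁻¹ • v) : U) : V)) :
          TangentSpace 𝓘(ℝ, V) ((extChartAt 𝓘(ℝ, V) u₀).symm (‖v‖⁻¹ • v))) := by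
  rw [normalize_smul ht v]

omit [FiniteDimensional ℝ V] in
/-- **himm: `dι_v z = 0` with `z ⊥ v` forces `z = 0`.** [folklore] -/
theorem mfderiv_spherePresentation_eq_zero (u₀ : U) (hSU : ∀ w : V, ‖w‖ = 1 → w ∈ U) {v z : V}
    (hv : v ≠ 0) (hz : ⟪v, z⟫ = 0)
    (h0 : mfderiv 𝓘(ℝ, V) 𝓘(ℝ, V) (fun v : V ↦ (extChartAt 𝓘(ℝ, V) u₀).symm (‖v‖⁻¹ • v)) v z = 0) :
    z = 0 := by
  rw [mfderiv_spherePresentation_apply u₀ hSU hv z] at h0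
  exact fderiv_normalize_injOn hv hz h0

end Literature.Geometry.Riemannian

end
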